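import Literature.Probability.Percolation.PercolationProofs
import Literature.Probability.LatticeModels.StarBoundary
import Literature.Probability.Percolation.PlanarDuality
import Literature.Probability.LatticeModels.LatticeWalkCrossing
import HarnessLib

/-!
# Crux `PercBurnResprinkle.VacantReignition` (stmt-CriticalPhenomena-7203), line `holes-are-fresh`,
# stub `stub_coarseGlue` — auxiliary file: planar crossing geometry and the lift `ι : ℤ² → ℤ³`

Pure-theorem helper file (lead prover-line-stmt-CriticalPhenomena-7203-c1-0, worker on `stub_coarseGlue`;
lands with `--supports stmt-CriticalPhenomena-7203`) for the COARSE GLUING step (Ahlberg–Duminil-Copin–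
Kozma–Sidoravicius, arXiv:1302.6872 §2, proof of Thm 1 p. 6, step 2) of the line.  Everything is stated
for an abstract planar predicate `g` (resp. block predicate `G` on `ℤ³`), coarse spacing `S : ℕ`, and
the rectangles `H(x) = [Sx₀-S, Sx₀+2S] × [Sx₁, Sx₁+S]`, `V(x) = [Sx₀, Sx₀+S] × [Sx₁-S, Sx₁+2S]` of a
coarse site `x ∈ ℤ²`, written out coordinatewise (no definitions).  The anchor of this file in the
work item is the registered helper stub `vacantReignition_cg_meet` (stated verbatim, all binders after
the colon); the registered line stub `stub_coarseGlue` itself is proved in the main file.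

* `vacantReignition_cg_meet` — a walk traversing the columns `[L, R]` inside the rows `[B, T]` and a
  walk traversing the rows `[B, T]` inside the columns `[L, R]` meet: their sub-walks spanning the slabs
  exactly (`exists_subwalk_slab`) are a left-right and a bottom-top crossing of `[L,R] × [B,T]`, which
  meet by the discrete Jordan-curve lemma `exists_mem_support_of_crossing` of `PlanarDuality.lean`.
* `vacantReignition_cg_lift`, `_lift_mem` — a planar nearest-neighbour walk of blocks `z` with
  `G (ι z)`, `ι z = (0, z₀, z₁)`, is an open path of the block configuration
  `{E ∈ E(ℤ³) | both endpoints satisfy G}` (`zdGraph_adj_iff`, `openGraph_adj`); `ι` is injective.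
* `vacantReignition_cg_site` — ALL OR NOTHING: for a set `T` closed under planar `g`-walks and a site
  with a good H- and a good V-crossing, if some good crossing touches `T` then every good H-crossing
  of `H(x)` and every good V-crossing of `V(x)` lies in `T` (any H- and V-crossing of `x` meet in the
  square `[Sx₀, Sx₀+S] × [Sx₁, Sx₁+S]`).
* `vacantReignition_cg_step` — the same conclusion passes from an open site `x` to an open
  `★`-neighbour `x'`: a crossing of `x` meets a crossing of `x'` in a common `S × S` square
  (`x' = x + e₁ (± e₂)`: `H(x)` and `V(x')`; `x' = x + e₂`: `V(x)` and `H(x')`; mirror cases).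
* `vacantReignition_cg_finite` — the start `a` of an H-crossing of `x` (`a₀ = Sx₀ - S`,
  `Sx₁ ≤ a₁ ≤ Sx₁ + S`) determines `x` up to finitely many choices (`S ≥ 1`).

References: D. Ahlberg, H. Duminil-Copin, G. Kozma, V. Sidoravicius, *Seven-dimensional forest fires*,
AIHP 51 (2015), §2 [AhlbergEtAl2015]; H. Kesten, *Percolation theory for mathematicians* (1982), §2.2
(a horizontal and a vertical crossing of a rectangle meet) [KestenPTM1982].  No measure theory, no new
definitions.
-/

noncomputable section

namespace Summit.CriticalPhenomena.PercolationContinuityZ3.Theorems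

open Literature.Probability.Percolation Literature.Probability.LatticeModels

/-! ## Planar geometry: crossings meet -/

/-- **Transversal walks of a rectangle meet.**  If `P` runs from (weakly) left of column `L` to
(weakly) right of column `R` inside the rows `[B, T]`, and `Q` from below row `B` to above row `T`
inside the columns `[L, R]`, then `P` and `Q` have a common vertex: the sub-walks spanning the two
slabs exactly (`exists_subwalk_slab`) are a left-right and a bottom-top crossing of `[L,R] × [B,T]`,
which meet by `exists_mem_support_of_crossing` (Kesten 1982, §2.2). [folklore] -/
theorem vacantReignition_cg_meet : ∀ {a b c d : Fin 2 → ℤ} (P : (zdGraph 2).Walk a b)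
    (Q : (zdGraph 2).Walk c d) {L R B T : ℤ}, L ≤ R → B ≤ T → a 0 ≤ L → R ≤ b 0 →
    (∀ z ∈ P.support, B ≤ z 1 ∧ z 1 ≤ T) → c 1 ≤ B → T ≤ d 1 →
    (∀ z ∈ Q.support, L ≤ z 0 ∧ z 0 ≤ R) → ∃ z ∈ P.support, z ∈ Q.support := by
  intro a b c d P Q L R B T hLR hBT ha hb hP hc hd hQ
  obtain ⟨u, v, P', hu, hv, hP'sub, hP'⟩ := exists_subwalk_slab P 0 ha hb hLR
  obtain ⟨u', v', Q', hu', hv', hQ'sub, hQ'⟩ := exists_subwalk_slab Q 1 hc hd hBT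
  obtain ⟨z, hzP, hzQ⟩ := exists_mem_support_of_crossing P' Q'
    (fun z hz => ⟨(hP' z hz).1, (hP' z hz).2, hP z (hP'sub z hz)⟩)
    (fun z hz => ⟨(hQ z (hQ'sub z hz)).1, (hQ z (hQ'sub z hz)).2, hQ' z hz⟩) hu hv hu' hv'
  exact ⟨z, hP'sub z hzP, hQ'sub z hzQ⟩

/-- Coarse coordinates of `★`-neighbours: `|m - n| ≤ 1` gives `S m - S ≤ S n ≤ S m + S`. [folklore] -/
theorem vacantReignition_cg_mul_bounds (S : ℕ) {m n : ℤ} (h : (m - n).natAbs ≤ 1) :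
    (S : ℤ) * m - S ≤ S * n ∧ (S : ℤ) * n ≤ S * m + S := by
  have hS : (0 : ℤ) ≤ S := Nat.cast_nonneg S
  have h1 : m - 1 ≤ n := by omega
  have h2 : n ≤ m + 1 := by omega
  constructor
  · have := mul_le_mul_of_nonneg_left h1 hS; linarith
  · have := mul_le_mul_of_nonneg_left h2 hS; linarith

/-- **Finite fibres of `x ↦ a(x)`.**  For `S ≥ 1` and a planar point `z`, only finitely many coarse
sites `x` have `S x₀ - S = z₀` and `S x₁ ≤ z₁ ≤ S x₁ + S` (all lie in the box of radius
`|z₀| + |z₁| + S`). [folklore] -/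
theorem vacantReignition_cg_finite (S : ℕ) (hS : 1 ≤ S) (z : Fin 2 → ℤ) :
    {x : Fin 2 → ℤ | (S : ℤ) * x 0 - S = z 0 ∧ (S : ℤ) * x 1 ≤ z 1 ∧ z 1 ≤ (S : ℤ) * x 1 + S}.Finite := by
  refine (box 2 ((z 0).natAbs + (z 1).natAbs + S)).finite_toSet.subset ?_
  intro x hx
  simp only [Set.mem_setOf_eq] at hx
  obtain ⟨h0, h1, h2⟩ := hx
  rw [Finset.mem_coe, mem_box]
  have key : ∀ i, (x i).natAbs ≤ ((S : ℤ) * x i).natAbs := fun i => by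
    rw [Int.natAbs_mul, Int.natAbs_natCast]; exact Nat.le_mul_of_pos_left _ hS
  have k0 := key 0
  have k1 := key 1
  refine Fin.forall_fin_two.2 ⟨?_, ?_⟩ <;> omega

/-! ## The lift `ι : ℤ² → ℤ³`, `ι z = (0, z₀, z₁)` -/

/-- `ι` maps nearest neighbours of `ℤ²` to nearest neighbours of `ℤ³` (`zdGraph_adj_iff`). [folklore] -/
theorem vacantReignition_cg_iota_adj {u v : Fin 2 → ℤ} (h : (zdGraph 2).Adj u v) :
    (zdGraph 3).Adj (![0, u 0, u 1] : Fin 3 → ℤ) ![0, v 0, v 1] := by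
  rw [zdGraph_adj_iff] at h ⊢
  obtain ⟨i, hi⟩ := h
  refine ⟨i.succ, ?_⟩
  rcases hi with rfl | rfl
  · left; funext j
    fin_cases i <;> fin_cases j <;> simp
  · right; funext j
    fin_cases i <;> fin_cases j <;> simp

/-- `ι` is injective. [folklore] -/
theorem vacantReignition_cg_iota_injective :
    Function.Injective (fun z : Fin 2 → ℤ => (![0, z 0, z 1] : Fin 3 → ℤ)) := by
  intro z z' h
  have h1 : z 0 = z' 0 := congrFun h 1
  have h2 : z 1 = z' 1 := congrFun h 2
  exact Site.eq_iff_two.2 ⟨h1, h2⟩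

/-- **Lift of planar walks of good blocks.**  If every block `ι z` along a planar nearest-neighbour
walk from `a` to `b` satisfies `G`, then `ι a` and `ι b` are joined in the block configuration
`{E ∈ E(ℤ³) | both endpoints satisfy G}` (induction on the walk; `openGraph_adj`). [folklore] -/
theorem vacantReignition_cg_lift (G : (Fin 3 → ℤ) → Prop) {a b : Fin 2 → ℤ}
    (P : (zdGraph 2).Walk a b) (hP : ∀ z ∈ P.support, G ![0, z 0, z 1]) :
    (openGraph {E : Sym2 (Fin 3 → ℤ) | E ∈ (zdGraph 3).edgeSet ∧ ∀ x ∈ E, G x}).Reachable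
      (![0, a 0, a 1] : Fin 3 → ℤ) ![0, b 0, b 1] := by
  induction P with
  | nil => exact SimpleGraph.Reachable.refl _
  | @cons u v w huv P ih =>
    have hu : G ![0, u 0, u 1] := hP u (SimpleGraph.Walk.start_mem_support _)
    have hP' : ∀ z ∈ P.support, G ![0, z 0, z 1] := fun z hz =>
      hP z (by rw [SimpleGraph.Walk.support_cons]; exact List.mem_cons_of_mem _ hz)
    have hv : G ![0, v 0, v 1] := hP' v (SimpleGraph.Walk.start_mem_support _)
    refine SimpleGraph.Reachable.trans (SimpleGraph.Adj.reachable ?_) (ih hP')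
    have h3 := vacantReignition_cg_iota_adj huv
    rw [openGraph_adj]
    refine ⟨⟨(SimpleGraph.mem_edgeSet _).2 h3, ?_⟩, h3.ne⟩
    intro x hx
    rcases Sym2.mem_iff.1 hx with rfl | rfl
    · exact hu
    · exact hv

/-- Every block along a planar walk of good blocks is joined to the lift of its start
(`vacantReignition_cg_lift` for the prefix `takeUntil`). [folklore] -/
theorem vacantReignition_cg_lift_mem (G : (Fin 3 → ℤ) → Prop) {a b : Fin 2 → ℤ}
    (P : (zdGraph 2).Walk a b) (hP : ∀ z ∈ P.support, G ![0, z 0, z 1]) {z : Fin 2 → ℤ}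
    (hz : z ∈ P.support) :
    (openGraph {E : Sym2 (Fin 3 → ℤ) | E ∈ (zdGraph 3).edgeSet ∧ ∀ x ∈ E, G x}).Reachable
      (![0, a 0, a 1] : Fin 3 → ℤ) ![0, z 0, z 1] := by
  classical
  exact vacantReignition_cg_lift G (P.takeUntil z hz) fun w hw =>
    hP w (P.support_takeUntil_subset_support hz hw)

/-! ## Chaining crossings along the `★`-cluster of open coarse sites -/

/-- **All or nothing at an open site.**  Let `T` be a set of planar points closed under planar walks
of `g`-good points, and let `x` be a coarse site having a `g`-good horizontal crossing of `H(x)` and a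
`g`-good vertical crossing of `V(x)`.  If SOME `g`-good crossing of `x` (horizontal or vertical) has a
vertex in `T`, then EVERY `g`-good horizontal crossing of `H(x)` and every `g`-good vertical crossing
of `V(x)` lies entirely in `T` — any horizontal and any vertical crossing of `x` meet in the square
`[Sx₀, Sx₀+S] × [Sx₁, Sx₁+S]` (`vacantReignition_cg_meet`). [folklore] -/
theorem vacantReignition_cg_site (S : ℕ) (g : (Fin 2 → ℤ) → Prop) (T : Set (Fin 2 → ℤ))
    (hT : ∀ (a b : Fin 2 → ℤ) (P : (zdGraph 2).Walk a b), (∀ z ∈ P.support, g z) →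
      (∃ z ∈ P.support, z ∈ T) → ∀ z ∈ P.support, z ∈ T)
    (x : Fin 2 → ℤ)
    (hH : ∃ a b : Fin 2 → ℤ, a 0 = (S : ℤ) * x 0 - S ∧ b 0 = (S : ℤ) * x 0 + 2 * S ∧
      ∃ P : (zdGraph 2).Walk a b, ∀ z ∈ P.support, ((S : ℤ) * x 0 - S ≤ z 0 ∧
        z 0 ≤ (S : ℤ) * x 0 + 2 * S ∧ (S : ℤ) * x 1 ≤ z 1 ∧ z 1 ≤ (S : ℤ) * x 1 + S) ∧ g z)
    (hV : ∃ a b : Fin 2 → ℤ, a 1 = (S : ℤ) * x 1 - S ∧ b 1 = (S : ℤ) * x 1 + 2 * S ∧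
      ∃ P : (zdGraph 2).Walk a b, ∀ z ∈ P.support, ((S : ℤ) * x 0 ≤ z 0 ∧
        z 0 ≤ (S : ℤ) * x 0 + S ∧ (S : ℤ) * x 1 - S ≤ z 1 ∧ z 1 ≤ (S : ℤ) * x 1 + 2 * S) ∧ g z)
    (htouch : (∃ a b : Fin 2 → ℤ, a 0 = (S : ℤ) * x 0 - S ∧ b 0 = (S : ℤ) * x 0 + 2 * S ∧
        ∃ P : (zdGraph 2).Walk a b, (∀ z ∈ P.support, ((S : ℤ) * x 0 - S ≤ z 0 ∧
          z 0 ≤ (S : ℤ) * x 0 + 2 * S ∧ (S : ℤ) * x 1 ≤ z 1 ∧ z 1 ≤ (S : ℤ) * x 1 + S) ∧ g z) ∧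
          ∃ z ∈ P.support, z ∈ T) ∨
      (∃ a b : Fin 2 → ℤ, a 1 = (S : ℤ) * x 1 - S ∧ b 1 = (S : ℤ) * x 1 + 2 * S ∧
        ∃ P : (zdGraph 2).Walk a b, (∀ z ∈ P.support, ((S : ℤ) * x 0 ≤ z 0 ∧
          z 0 ≤ (S : ℤ) * x 0 + S ∧ (S : ℤ) * x 1 - S ≤ z 1 ∧ z 1 ≤ (S : ℤ) * x 1 + 2 * S) ∧ g z) ∧
          ∃ z ∈ P.support, z ∈ T)) :
    (∀ (a b : Fin 2 → ℤ) (P : (zdGraph 2).Walk a b), a 0 = (S : ℤ) * x 0 - S →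
      b 0 = (S : ℤ) * x 0 + 2 * S → (∀ z ∈ P.support, ((S : ℤ) * x 0 - S ≤ z 0 ∧
        z 0 ≤ (S : ℤ) * x 0 + 2 * S ∧ (S : ℤ) * x 1 ≤ z 1 ∧ z 1 ≤ (S : ℤ) * x 1 + S) ∧ g z) →
      ∀ z ∈ P.support, z ∈ T) ∧
    (∀ (a b : Fin 2 → ℤ) (P : (zdGraph 2).Walk a b), a 1 = (S : ℤ) * x 1 - S →
      b 1 = (S : ℤ) * x 1 + 2 * S → (∀ z ∈ P.support, ((S : ℤ) * x 0 ≤ z 0 ∧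
        z 0 ≤ (S : ℤ) * x 0 + S ∧ (S : ℤ) * x 1 - S ≤ z 1 ∧ z 1 ≤ (S : ℤ) * x 1 + 2 * S) ∧ g z) →
      ∀ z ∈ P.support, z ∈ T) := by
  -- every horizontal crossing of `H(x)` meets every vertical crossing of `V(x)` (in the square `Q(x)`)
  have HV : ∀ (a b : Fin 2 → ℤ) (P : (zdGraph 2).Walk a b), a 0 = (S : ℤ) * x 0 - S →
      b 0 = (S : ℤ) * x 0 + 2 * S → (∀ z ∈ P.support, ((S : ℤ) * x 0 - S ≤ z 0 ∧
        z 0 ≤ (S : ℤ) * x 0 + 2 * S ∧ (S : ℤ) * x 1 ≤ z 1 ∧ z 1 ≤ (S : ℤ) * x 1 + S) ∧ g z) →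
      ∀ (c d : Fin 2 → ℤ) (Q : (zdGraph 2).Walk c d), c 1 = (S : ℤ) * x 1 - S →
      d 1 = (S : ℤ) * x 1 + 2 * S → (∀ z ∈ Q.support, ((S : ℤ) * x 0 ≤ z 0 ∧
        z 0 ≤ (S : ℤ) * x 0 + S ∧ (S : ℤ) * x 1 - S ≤ z 1 ∧ z 1 ≤ (S : ℤ) * x 1 + 2 * S) ∧ g z) →
      ∃ m ∈ P.support, m ∈ Q.support := by
    intro a b P ha hb hP c d Q hc hd hQ
    exact vacantReignition_cg_meet P Q (L := (S : ℤ) * x 0) (R := (S : ℤ) * x 0 + S)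
      (B := (S : ℤ) * x 1) (T := (S : ℤ) * x 1 + S) (by omega) (by omega) (by omega) (by omega)
      (fun z hz => ⟨(hP z hz).1.2.2.1, (hP z hz).1.2.2.2⟩) (by omega) (by omega)
      (fun z hz => ⟨(hQ z hz).1.1, (hQ z hz).1.2.1⟩)
  -- a horizontal crossing touching `T` puts every vertical crossing inside `T`
  have step1 : (∃ a b : Fin 2 → ℤ, a 0 = (S : ℤ) * x 0 - S ∧ b 0 = (S : ℤ) * x 0 + 2 * S ∧
        ∃ P : (zdGraph 2).Walk a b, (∀ z ∈ P.support, ((S : ℤ) * x 0 - S ≤ z 0 ∧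
          z 0 ≤ (S : ℤ) * x 0 + 2 * S ∧ (S : ℤ) * x 1 ≤ z 1 ∧ z 1 ≤ (S : ℤ) * x 1 + S) ∧ g z) ∧
          ∃ z ∈ P.support, z ∈ T) →
      ∀ (c d : Fin 2 → ℤ) (Q : (zdGraph 2).Walk c d), c 1 = (S : ℤ) * x 1 - S →
      d 1 = (S : ℤ) * x 1 + 2 * S → (∀ z ∈ Q.support, ((S : ℤ) * x 0 ≤ z 0 ∧
        z 0 ≤ (S : ℤ) * x 0 + S ∧ (S : ℤ) * x 1 - S ≤ z 1 ∧ z 1 ≤ (S : ℤ) * x 1 + 2 * S) ∧ g z) →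
      ∀ z ∈ Q.support, z ∈ T := by
    rintro ⟨a, b, ha, hb, P, hP, hz₁⟩ c d Q hc hd hQ
    have hPT : ∀ z ∈ P.support, z ∈ T := hT a b P (fun z hz => (hP z hz).2) hz₁
    obtain ⟨m, hmP, hmQ⟩ := HV a b P ha hb hP c d Q hc hd hQ
    exact hT c d Q (fun z hz => (hQ z hz).2) ⟨m, hmQ, hPT m hmP⟩
  -- a vertical crossing touching `T` puts every horizontal crossing inside `T`
  have step2 : (∃ a b : Fin 2 → ℤ, a 1 = (S : ℤ) * x 1 - S ∧ b 1 = (S : ℤ) * x 1 + 2 * S ∧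
        ∃ P : (zdGraph 2).Walk a b, (∀ z ∈ P.support, ((S : ℤ) * x 0 ≤ z 0 ∧
          z 0 ≤ (S : ℤ) * x 0 + S ∧ (S : ℤ) * x 1 - S ≤ z 1 ∧ z 1 ≤ (S : ℤ) * x 1 + 2 * S) ∧ g z) ∧
          ∃ z ∈ P.support, z ∈ T) →
      ∀ (a b : Fin 2 → ℤ) (P : (zdGraph 2).Walk a b), a 0 = (S : ℤ) * x 0 - S →
      b 0 = (S : ℤ) * x 0 + 2 * S → (∀ z ∈ P.support, ((S : ℤ) * x 0 - S ≤ z 0 ∧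
        z 0 ≤ (S : ℤ) * x 0 + 2 * S ∧ (S : ℤ) * x 1 ≤ z 1 ∧ z 1 ≤ (S : ℤ) * x 1 + S) ∧ g z) →
      ∀ z ∈ P.support, z ∈ T := by
    rintro ⟨c, d, hc, hd, Q, hQ, hz₁⟩ a b P ha hb hP
    have hQT : ∀ z ∈ Q.support, z ∈ T := hT c d Q (fun z hz => (hQ z hz).2) hz₁
    obtain ⟨m, hmP, hmQ⟩ := HV a b P ha hb hP c d Q hc hd hQ
    exact hT a b P (fun z hz => (hP z hz).2) ⟨m, hmP, hQT m hmQ⟩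
  rcases htouch with h | h
  · refine ⟨step2 ?_, step1 h⟩
    obtain ⟨c, d, hc, hd, Q, hQ⟩ := hV
    exact ⟨c, d, hc, hd, Q, hQ, c, Q.start_mem_support,
      step1 h c d Q hc hd hQ c Q.start_mem_support⟩
  · refine ⟨step2 h, step1 ?_⟩
    obtain ⟨a, b, ha, hb, P, hP⟩ := hH
    exact ⟨a, b, ha, hb, P, hP, a, P.start_mem_support,
      step2 h a b P ha hb hP a P.start_mem_support⟩

/-- **Crossings of `★`-adjacent open sites meet** (ADKS p. 6: "the crossings of neighbouring good
sites intersect").  With `T` as in `vacantReignition_cg_site`: if all good crossings of the open site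
`x` lie in `T` and `x'` is an open `★`-neighbour of `x`, then all good crossings of `x'` lie in `T`.
Cases on `x' - x ∈ {±e₁ + {0, ±e₂}, ±e₂}`: `H(x)`/`V(x')` meet in `[Sx₀+S, Sx₀+2S] × [Sx₁, Sx₁+S]`
(`x' = x + e₁ ± …`), `V(x)`/`H(x')` in `[Sx₀, Sx₀+S] × [Sx₁+S, Sx₁+2S]` (`x' = x + e₂`), and the
mirror cases; then `vacantReignition_cg_site`. [cite: AhlbergEtAl2015, §2 (proof of Thm 1, p. 6)] -/
theorem vacantReignition_cg_step (S : ℕ) (g : (Fin 2 → ℤ) → Prop) (T : Set (Fin 2 → ℤ))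
    (hT : ∀ (a b : Fin 2 → ℤ) (P : (zdGraph 2).Walk a b), (∀ z ∈ P.support, g z) →
      (∃ z ∈ P.support, z ∈ T) → ∀ z ∈ P.support, z ∈ T)
    {x x' : Fin 2 → ℤ} (hadj : (zdStar 2).Adj x x')
    (hx : (∃ a b : Fin 2 → ℤ, a 0 = (S : ℤ) * x 0 - S ∧ b 0 = (S : ℤ) * x 0 + 2 * S ∧
      ∃ P : (zdGraph 2).Walk a b, ∀ z ∈ P.support, ((S : ℤ) * x 0 - S ≤ z 0 ∧
        z 0 ≤ (S : ℤ) * x 0 + 2 * S ∧ (S : ℤ) * x 1 ≤ z 1 ∧ z 1 ≤ (S : ℤ) * x 1 + S) ∧ g z) ∧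
      (∃ a b : Fin 2 → ℤ, a 1 = (S : ℤ) * x 1 - S ∧ b 1 = (S : ℤ) * x 1 + 2 * S ∧
      ∃ P : (zdGraph 2).Walk a b, ∀ z ∈ P.support, ((S : ℤ) * x 0 ≤ z 0 ∧
        z 0 ≤ (S : ℤ) * x 0 + S ∧ (S : ℤ) * x 1 - S ≤ z 1 ∧ z 1 ≤ (S : ℤ) * x 1 + 2 * S) ∧ g z))
    (hx' : (∃ a b : Fin 2 → ℤ, a 0 = (S : ℤ) * x' 0 - S ∧ b 0 = (S : ℤ) * x' 0 + 2 * S ∧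
      ∃ P : (zdGraph 2).Walk a b, ∀ z ∈ P.support, ((S : ℤ) * x' 0 - S ≤ z 0 ∧
        z 0 ≤ (S : ℤ) * x' 0 + 2 * S ∧ (S : ℤ) * x' 1 ≤ z 1 ∧ z 1 ≤ (S : ℤ) * x' 1 + S) ∧ g z) ∧
      (∃ a b : Fin 2 → ℤ, a 1 = (S : ℤ) * x' 1 - S ∧ b 1 = (S : ℤ) * x' 1 + 2 * S ∧
      ∃ P : (zdGraph 2).Walk a b, ∀ z ∈ P.support, ((S : ℤ) * x' 0 ≤ z 0 ∧
        z 0 ≤ (S : ℤ) * x' 0 + S ∧ (S : ℤ) * x' 1 - S ≤ z 1 ∧ z 1 ≤ (S : ℤ) * x' 1 + 2 * S) ∧ g z))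
    (hin : (∀ (a b : Fin 2 → ℤ) (P : (zdGraph 2).Walk a b), a 0 = (S : ℤ) * x 0 - S →
      b 0 = (S : ℤ) * x 0 + 2 * S → (∀ z ∈ P.support, ((S : ℤ) * x 0 - S ≤ z 0 ∧
        z 0 ≤ (S : ℤ) * x 0 + 2 * S ∧ (S : ℤ) * x 1 ≤ z 1 ∧ z 1 ≤ (S : ℤ) * x 1 + S) ∧ g z) →
      ∀ z ∈ P.support, z ∈ T) ∧
    (∀ (a b : Fin 2 → ℤ) (P : (zdGraph 2).Walk a b), a 1 = (S : ℤ) * x 1 - S →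
      b 1 = (S : ℤ) * x 1 + 2 * S → (∀ z ∈ P.support, ((S : ℤ) * x 0 ≤ z 0 ∧
        z 0 ≤ (S : ℤ) * x 0 + S ∧ (S : ℤ) * x 1 - S ≤ z 1 ∧ z 1 ≤ (S : ℤ) * x 1 + 2 * S) ∧ g z) →
      ∀ z ∈ P.support, z ∈ T)) :
    (∀ (a b : Fin 2 → ℤ) (P : (zdGraph 2).Walk a b), a 0 = (S : ℤ) * x' 0 - S →
      b 0 = (S : ℤ) * x' 0 + 2 * S → (∀ z ∈ P.support, ((S : ℤ) * x' 0 - S ≤ z 0 ∧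
        z 0 ≤ (S : ℤ) * x' 0 + 2 * S ∧ (S : ℤ) * x' 1 ≤ z 1 ∧ z 1 ≤ (S : ℤ) * x' 1 + S) ∧ g z) →
      ∀ z ∈ P.support, z ∈ T) ∧
    (∀ (a b : Fin 2 → ℤ) (P : (zdGraph 2).Walk a b), a 1 = (S : ℤ) * x' 1 - S →
      b 1 = (S : ℤ) * x' 1 + 2 * S → (∀ z ∈ P.support, ((S : ℤ) * x' 0 ≤ z 0 ∧
        z 0 ≤ (S : ℤ) * x' 0 + S ∧ (S : ℤ) * x' 1 - S ≤ z 1 ∧ z 1 ≤ (S : ℤ) * x' 1 + 2 * S) ∧ g z) →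
      ∀ z ∈ P.support, z ∈ T) := by
  have h0 := natAbs_sub_le_one_of_adj hadj 0
  have h1 := natAbs_sub_le_one_of_adj hadj 1
  obtain ⟨hb1, hb1'⟩ := vacantReignition_cg_mul_bounds S h1
  apply vacantReignition_cg_site S g T hT x' hx'.1 hx'.2
  rcases (by omega : x' 0 = x 0 + 1 ∨ x' 0 = x 0 - 1 ∨ x' 0 = x 0) with he | he | he
  · -- `x' = x + e₁ (± e₂)`: `H(x)` meets `V(x')` in `[Sx₀+S, Sx₀+2S] × [Sx₁, Sx₁+S]`
    have hSe : (S : ℤ) * x' 0 = S * x 0 + S := by rw [he]; ring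
    obtain ⟨a, b, ha, hb, P, hP⟩ := hx.1
    obtain ⟨c, d, hc, hd, Q, hQ⟩ := hx'.2
    obtain ⟨m, hmP, hmQ⟩ := vacantReignition_cg_meet P Q (L := (S : ℤ) * x 0 + S)
      (R := (S : ℤ) * x 0 + 2 * S) (B := (S : ℤ) * x 1) (T := (S : ℤ) * x 1 + S)
      (by omega) (by omega) (by omega) (by omega)
      (fun z hz => ⟨(hP z hz).1.2.2.1, (hP z hz).1.2.2.2⟩) (by omega) (by omega)
      (fun z hz => ⟨by have := (hQ z hz).1.1; omega, by have := (hQ z hz).1.2.1; omega⟩)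
    exact Or.inr ⟨c, d, hc, hd, Q, hQ, m, hmQ, hin.1 a b P ha hb hP m hmP⟩
  · -- `x' = x - e₁ (± e₂)`: `H(x')` meets `V(x)` in `[Sx₀, Sx₀+S] × [Sx'₁, Sx'₁+S]`
    have hSe : (S : ℤ) * x' 0 = S * x 0 - S := by rw [he]; ring
    obtain ⟨a, b, ha, hb, P, hP⟩ := hx'.1
    obtain ⟨c, d, hc, hd, Q, hQ⟩ := hx.2
    obtain ⟨m, hmP, hmQ⟩ := vacantReignition_cg_meet P Q (L := (S : ℤ) * x 0)
      (R := (S : ℤ) * x 0 + S) (B := (S : ℤ) * x' 1) (T := (S : ℤ) * x' 1 + S)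
      (by omega) (by omega) (by omega) (by omega)
      (fun z hz => ⟨(hP z hz).1.2.2.1, (hP z hz).1.2.2.2⟩) (by omega) (by omega)
      (fun z hz => ⟨(hQ z hz).1.1, (hQ z hz).1.2.1⟩)
    exact Or.inl ⟨a, b, ha, hb, P, hP, m, hmP, hin.2 c d Q hc hd hQ m hmQ⟩
  · have hSe : (S : ℤ) * x' 0 = S * x 0 := by rw [he]
    rcases (by omega : x' 1 = x 1 + 1 ∨ x' 1 = x 1 - 1 ∨ x' 1 = x 1) with he' | he' | he'
    · -- `x' = x + e₂`: `H(x')` meets `V(x)` in `[Sx₀, Sx₀+S] × [Sx₁+S, Sx₁+2S]`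
      have hSe' : (S : ℤ) * x' 1 = S * x 1 + S := by rw [he']; ring
      obtain ⟨a, b, ha, hb, P, hP⟩ := hx'.1
      obtain ⟨c, d, hc, hd, Q, hQ⟩ := hx.2
      obtain ⟨m, hmP, hmQ⟩ := vacantReignition_cg_meet P Q (L := (S : ℤ) * x 0)
        (R := (S : ℤ) * x 0 + S) (B := (S : ℤ) * x 1 + S) (T := (S : ℤ) * x 1 + 2 * S)
        (by omega) (by omega) (by omega) (by omega)
        (fun z hz => ⟨by have := (hP z hz).1.2.2.1; omega, by have := (hP z hz).1.2.2.2; omega⟩)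
        (by omega) (by omega) (fun z hz => ⟨(hQ z hz).1.1, (hQ z hz).1.2.1⟩)
      exact Or.inl ⟨a, b, ha, hb, P, hP, m, hmP, hin.2 c d Q hc hd hQ m hmQ⟩
    · -- `x' = x - e₂`: `H(x)` meets `V(x')` in `[Sx₀, Sx₀+S] × [Sx₁, Sx₁+S]`
      have hSe' : (S : ℤ) * x' 1 = S * x 1 - S := by rw [he']; ring
      obtain ⟨a, b, ha, hb, P, hP⟩ := hx.1
      obtain ⟨c, d, hc, hd, Q, hQ⟩ := hx'.2
      obtain ⟨m, hmP, hmQ⟩ := vacantReignition_cg_meet P Q (L := (S : ℤ) * x 0)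
        (R := (S : ℤ) * x 0 + S) (B := (S : ℤ) * x 1) (T := (S : ℤ) * x 1 + S)
        (by omega) (by omega) (by omega) (by omega)
        (fun z hz => ⟨(hP z hz).1.2.2.1, (hP z hz).1.2.2.2⟩) (by omega) (by omega)
        (fun z hz => ⟨by have := (hQ z hz).1.1; omega, by have := (hQ z hz).1.2.1; omega⟩)
      exact Or.inr ⟨c, d, hc, hd, Q, hQ, m, hmQ, hin.1 a b P ha hb hP m hmP⟩
    · exact (hadj.ne (Site.eq_iff_two.2 ⟨he.symm, he'.symm⟩)).elim

end Summit.CriticalPhenomena.PercolationContinuityZ3.Theorems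

end
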